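import Summits.BirchSwinnertonDyer.Rank1Residual.X11b.BDPRouteLocalKernelBound
import Summits.BirchSwinnertonDyer.Rank1Residual.X11b.AnticyclotomicGoodPlaces
import Literature.NumberTheory.EllipticCurves.PrimaryGroupStableImage
import HarnessLib

/-!
# Class X11b, route p2: the local kernel through the INERTIA group —
# `ker r_v ⊆ ker (H¹(D_v, E[p^∞]) → H¹(I_v, E[p^∞])) ↪ E(K̄)^{I_v}[p^∞]/(φ_v − 1)`, and the
# Tamagawa algebra with `M₀ ≤ E(K̄)^{I_v}` (cell `b2b-bsdres`, sub-cell `multr1-p2`, gen 14)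

HONEST FRAMING (verbatim, cell `b2b-bsdres`): the goal of the cell is to DELETE the
COMBINATION-SHAPED residual classes for ALL analytic-rank `≤ 1` curves over `ℚ` — "full BSD
formula for every rank `≤ 1` curve in class `C`" assembled STRICTLY from published theorems — so
that the rank-`≤ 1` remainder becomes exactly the CONSTRUCTION-SHAPED classes, which are TYPED
(missing-input Props), NOT attempted; this is not "finishing BSD". Research route `p2` for class
X11b; no claim beyond the stated class; nothing booked; X11b stays CONSTRUCTION-SHAPED. One
definition with a body (`inertiaSubOne`, the endomorphism `φ_v − 1` of `M^{I_v}`), one `AddEquiv`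
with a body, and theorems; no named fact; no `sorry`.

## Why this file

Gen 13 (`BDPRouteLocalKernelCoinvariants`, `BDPRouteLocalKernelBound`) bounded Greenberg's local
kernel `ker r_v = ker (H¹(K_v, E[p^∞]) → H¹(K_{∞,w}, E[p^∞]))` through the coinvariants of
`B_v = E[p^∞]^{ker κ ⊓ D_v}` under a generator `γ_v` of `D_v` modulo `D_v ⊓ ker κ`, leaving four
facts about the subgroup `E₀(K_{∞,w})` of non-singular reduction INSIDE THE `ℤ_p`-TOWER. The tree's
local reduction theory (Kodaira–Néron over `K_v^{nr}`, `KodairaNeronUnramified`; the reduction map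
and `E₀`/`E₁` on `K̄_v`-points, `ReductionHomomorphism`; Silverman *ATAEC* IV.10.2 via
`InertiaInvariants*Proofs`) lives over the MAXIMAL UNRAMIFIED extension, i.e. on the fixed points of
the INERTIA group. This file therefore re-runs the gen-13 argument one level up: since every
`ℤ_p`-extension is unramified at `v ∤ p` (`I_v ≤ ker κ`, tree
`ZpExtension.inertia_le_kerSubgroup_holds`),

  `ker r_v = ker (H¹(D_v, M) → H¹(D_v ⊓ ker κ, M)) ⊆ ker (H¹(D_v, M) → H¹(I_v, M))`
  `           ↪ M^{I_v}/(φ_v − 1)M^{I_v}`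

for an arithmetic Frobenius `φ_v ∈ D_v` at the chosen prime `𝔓₀ ∣ v` (generic embedding
`ResKernel.finite_subgroupResKer` of the tree, Frobenius generation
`exists_eq_frobenius_pow_mul_of_mem_decompositionSubgroup`), and then the Tamagawa algebra of
gen 13 (`TamagawaCoinvariants.natCard_primaryComponent_quotient_range_le`) with a `φ_v`-stable
finite-index `M₀ ≤ E(K̄)^{I_v} = E(K_v^{nr})^{alg}`: `#ker r_v ≤ p ^ ord_p [E(K̄)^{D_v} : E(K̄)^{D_v} ⊓ M₀]`,
provided `φ_v − 1` maps `M₀[p^∞]` onto itself — which, by the tree's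
`PrimaryGroup.le_range_of_finite_ker`, follows from `p M₀[p^∞] = M₀[p^∞]` (divisibility) and the
finiteness of the `D_v`-fixed `p`-power torsion. With `M₀ = E₀(K_v^{nr})^{alg}` the index is
`[E(K_v) : E₀(K_v)] = c_v` (Greenberg, LNM 1716, §3 Lemma 3.3 at a bad `v ∤ p`; proof of
Thm. 4.1, p. 74: "`ker r_v` … has order `c_v^{(p)}`"); the geometric inputs (`M₀`, its index, its
divisible torsion) are the business of the companion file `BDPRouteNonsingularPart.lean` (this generation).

## Content

* `conj_mem_inertia_of_mem_decomp`, `smul_mem_fixedPoints_inertia` — `I_v ⊴ D_v`, so `D_v` acts on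
  `M^{I_v}`; def `inertiaSubOne M g hg` = `g − 1` on `M^{I_v}` for `g ∈ D_v`.
* `inertia_frobenius_generate` — an arithmetic Frobenius `φ` at `𝔓₀` generates `D_v` topologically
  together with `I_v` (open subgroups of `D_v` containing `I_v` and `φ` are everything).
* **`finite_localKer_and_natCard_le_inertia`** — for `I_v ≤ H` (e.g. `H = ker κ`):
  `localKer H M v` is finite with `#localKer ≤ #(M^{I_v}/(φ − 1)M^{I_v})` when the latter is finite.
* `inertiaSubOne_eq_zero_iff` — `ker (φ − 1) = E(K̄)^{D_v}` on `E(K̄)^{I_v}`.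
* `fixedPrimaryEquivInertia` — `E[p^∞]^{I_v}` is the `p`-primary component of `E(K̄)^{I_v}`.
* The Tamagawa algebra itself (`#ker r_v ≤ p ^ ord_p [ker(φ−1) : ker(φ−1) ⊓ M₀]` for a `φ`-stable
  finite-index `M₀ ≤ E(K̄)^{I_v}` with divisible `M₀[p^∞]`) is the continuation file
  `BDPRouteLocalKernelInertiaBound.lean`.

CONDITIONAL use only (inputs of route p2's (CTL≤)ᵗ, `BDPRouteControlBadPlaces`); nothing booked;
reach and labels unchanged.

References: [GreenbergLNM1716] §3 Lemma 3.3 and its proof (p. 87), §4 proof of Thm. 4.1 (p. 74);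
[SerreGaloisCohomology1997] I.§2.6 (b) (inflation–restriction); [NeukirchANT1999] I §9 (9.4)–(9.6).
-/

noncomputable section

open scoped Classical Pointwise

open NumberField IsDedekindDomain Field
open Literature.NumberTheory.EllipticCurves Literature.NumberTheory.EllipticCurves.GreenbergSelmer
open Literature.NumberTheory.GaloisRepresentations Literature.NumberTheory.EllipticCurves.ResKernel

universe u

namespace Summit.BirchSwinnertonDyer.Rank1Residual.X11b.AcSelmer

/-! ## `I_v ⊴ D_v`: the action of `D_v` on `M^{I_v}` and the endomorphism `φ − 1` -/

section Algebra

variable {K : Type u} [Field K] [NumberField K]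
variable (M : Type u) [AddCommGroup M] [DistribMulAction (absoluteGaloisGroup K) M]
  {v : HeightOneSpectrum (𝓞 K)}

/-- `D_v = decomp v` is the decomposition group of the chosen prime `𝔓₀ = adicCompletionPrime K v`
(tree `decompositionSubgroup_adicCompletionPrime_eq_range`). [cite: NeukirchANT1999, Ch. II §9 Prop. (9.6)] -/
theorem decomp_eq_decompositionSubgroup_adicCompletionPrime (v : HeightOneSpectrum (𝓞 K)) :
    decomp v = (adicCompletionPrime K v).decompositionSubgroup (absoluteGaloisGroup K) := by
  rw [decompositionSubgroup_adicCompletionPrime_eq_range]; rfl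

/-- **`I_v` is normal in `D_v`**: for `g ∈ D_v` and `i ∈ I_v = I_{𝔓₀}`, `g⁻¹ i g ∈ I_v`
(`g` stabilises `𝔓₀`, `i` moves every integer into `𝔓₀`). [cite: NeukirchANT1999, Ch. I §9 (9.6) (`I_𝔓 ⊴ G_𝔓`)] -/
theorem conj_mem_inertia_of_mem_decomp {g i : absoluteGaloisGroup K} (hg : g ∈ decomp v)
    (hi : i ∈ (adicCompletionPrime K v).inertia (absoluteGaloisGroup K)) :
    g⁻¹ * i * g ∈ (adicCompletionPrime K v).inertia (absoluteGaloisGroup K) := by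
  rw [decomp_eq_decompositionSubgroup_adicCompletionPrime] at hg
  -- Mathlib: the inertia subgroup is normal in the stabiliser (= decomposition subgroup)
  have hN : ((adicCompletionPrime K v).inertia
      ↥((adicCompletionPrime K v).decompositionSubgroup (absoluteGaloisGroup K))).Normal :=
    inferInstance
  have hle : (adicCompletionPrime K v).inertia (absoluteGaloisGroup K) ≤
      (adicCompletionPrime K v).decompositionSubgroup (absoluteGaloisGroup K) :=
    Ideal.inertia_le_decompositionSubgroup _ _
  have hi' : (⟨i, hle hi⟩ : ↥((adicCompletionPrime K v).decompositionSubgroup (absoluteGaloisGroup K))) ∈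
      (adicCompletionPrime K v).inertia
        ↥((adicCompletionPrime K v).decompositionSubgroup (absoluteGaloisGroup K)) :=
    AddSubgroup.coe_mem_inertia.mp hi
  have h := hN.conj_mem _ hi' ⟨g⁻¹, inv_mem hg⟩
  have h' := AddSubgroup.coe_mem_inertia.mpr h
  simpa only [Subgroup.coe_mul, Subgroup.coe_inv, inv_inv] using h'

/-- `g ∈ D_v` maps the fixed points `M^{I_v}` into themselves (`I_v ⊴ D_v`). [folklore] -/
theorem smul_mem_fixedPoints_inertia {g : absoluteGaloisGroup K} (hg : g ∈ decomp v) {b : M}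
    (hb : b ∈ FixedPoints.addSubgroup
      ↥((adicCompletionPrime K v).inertia (absoluteGaloisGroup K)) M) :
    g • b ∈ FixedPoints.addSubgroup
      ↥((adicCompletionPrime K v).inertia (absoluteGaloisGroup K)) M := by
  intro x
  have hconj := conj_mem_inertia_of_mem_decomp (v := v) hg x.2
  show (x : absoluteGaloisGroup K) • g • b = g • b
  have h1 : (g⁻¹ * (x : absoluteGaloisGroup K) * g) • b = b := hb ⟨_, hconj⟩
  calc (x : absoluteGaloisGroup K) • g • b = g • (g⁻¹ * (x : absoluteGaloisGroup K) * g) • b := by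
        rw [← mul_smul, ← mul_smul]; congr 1; group
    _ = g • b := by rw [h1]

/-- **`φ − 1` on `M^{I_v}`** for `φ ∈ D_v` (Greenberg's `Frob_v − 1` on `E(K_v^{nr})[p^∞]`; its
cokernel is `H¹(D_v/I_v, M^{I_v}) = H¹_ur(K_v, M)`).
[cite: GreenbergLNM1716, §3 Lemma 3.3 (proof, p. 87)] -/
def inertiaSubOne {v : HeightOneSpectrum (𝓞 K)} (g : absoluteGaloisGroup K) (hg : g ∈ decomp v) :
    FixedPoints.addSubgroup ↥((adicCompletionPrime K v).inertia (absoluteGaloisGroup K)) M →+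
      FixedPoints.addSubgroup ↥((adicCompletionPrime K v).inertia (absoluteGaloisGroup K)) M where
  toFun b := ⟨g • (b : M) - b, (FixedPoints.addSubgroup _ M).sub_mem
    (smul_mem_fixedPoints_inertia M hg b.2) b.2⟩
  map_zero' := Subtype.ext (by simp)
  map_add' a b := Subtype.ext (by
    simp only [AddSubgroup.coe_add, smul_add, AddMemClass.mk_add_mk]
    abel)

/-- Unfolding `inertiaSubOne`: `(φ − 1) b = φ • b − b`. [folklore] -/
@[simp] theorem coe_inertiaSubOne_apply {v : HeightOneSpectrum (𝓞 K)} (g : absoluteGaloisGroup K)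
    (hg : g ∈ decomp v)
    (b : FixedPoints.addSubgroup ↥((adicCompletionPrime K v).inertia (absoluteGaloisGroup K)) M) :
    (inertiaSubOne M g hg b : M) = g • (b : M) - b := rfl

/-- **Frobenius generation of `D_v` modulo `I_v`, for open subgroups of `D_v`**: if `φ` is an
arithmetic Frobenius at `𝔓₀`, every open subgroup of `D_v` (in the shape `⊤ ⊓ D_v` carrying
`localKer`) containing `I_v` and `φ` is all of `D_v` (tree
`exists_eq_frobenius_pow_mul_of_mem_decompositionSubgroup`: `d = φⁿ·i·u` with `u` in any open
subgroup of `Γ_K`; an open subgroup of `D_v` contains `D_v ∩ Gal(K̄/F)` for a finite `F/K`,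
`krullTopology_mem_nhds_one_iff`). [cite: NeukirchANT1999, I §9 Prop. (9.4)] -/
theorem inertia_frobenius_generate {φ : absoluteGaloisGroup K}
    (hφ : IsArithFrobAt (𝓞 K) φ (adicCompletionPrime K v))
    (hφD : φ ∈ (⊤ : Subgroup (absoluteGaloisGroup K)) ⊓ decomp v) :
    ∀ U : Subgroup ↥((⊤ : Subgroup (absoluteGaloisGroup K)) ⊓ decomp v),
      IsOpen (U : Set ↥((⊤ : Subgroup (absoluteGaloisGroup K)) ⊓ decomp v)) →
        ((adicCompletionPrime K v).inertia (absoluteGaloisGroup K)).subgroupOf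
            ((⊤ : Subgroup (absoluteGaloisGroup K)) ⊓ decomp v) ≤ U →
          (⟨φ, hφD⟩ : ↥((⊤ : Subgroup (absoluteGaloisGroup K)) ⊓ decomp v)) ∈ U → U = ⊤ := by
  intro U hU hIU hφU
  have h𝔓₀ := adicCompletionPrime_mem_primesAbove K v
  have hIdec : (adicCompletionPrime K v).inertia (absoluteGaloisGroup K) ≤ decomp v := by
    rw [decomp_eq_decompositionSubgroup_adicCompletionPrime]
    exact Ideal.inertia_le_decompositionSubgroup _ _
  let D : Subgroup (absoluteGaloisGroup K) := (⊤ : Subgroup (absoluteGaloisGroup K)) ⊓ decomp v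
  -- an open subgroup of `Γ_K` inside `U`
  obtain ⟨t, ht, htU⟩ := isOpen_induced_iff.mp hU
  have h1t : (1 : absoluteGaloisGroup K) ∈ t := by
    have h1 : (1 : D) ∈ Subtype.val ⁻¹' t := by rw [htU]; exact U.one_mem
    exact h1
  obtain ⟨F, hFfin, hFt⟩ :=
    (krullTopology_mem_nhds_one_iff K (AlgebraicClosure K) t).mp (ht.mem_nhds h1t)
  haveI := hFfin
  rw [eq_top_iff]
  rintro ⟨d, hd⟩ -
  have hdD : d ∈ (adicCompletionPrime K v).decompositionSubgroup (absoluteGaloisGroup K) := by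
    rw [← decomp_eq_decompositionSubgroup_adicCompletionPrime]; exact (Subgroup.mem_inf.mp hd).2
  obtain ⟨n, i, w, hi, hw, hdeq⟩ := exists_eq_frobenius_pow_mul_of_mem_decompositionSubgroup h𝔓₀
    hφ (IntermediateField.fixingSubgroup_isOpen F) hdD
  have hiD : i ∈ D := Subgroup.mem_inf.mpr ⟨Subgroup.mem_top i, hIdec hi⟩
  have hwD : w ∈ D := by
    have e : w = (φ ^ n * i)⁻¹ * d := by rw [hdeq, inv_mul_cancel_left]
    rw [e]
    exact D.mul_mem (D.inv_mem (D.mul_mem (D.pow_mem hφD n) hiD)) hd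
  have hwU : (⟨w, hwD⟩ : D) ∈ U := by
    have h : (⟨w, hwD⟩ : D) ∈ Subtype.val ⁻¹' t := hFt hw
    rw [htU] at h
    exact h
  have hiU : (⟨i, hiD⟩ : D) ∈ U := hIU (Subgroup.mem_subgroupOf.mpr hi)
  have e : (⟨d, hd⟩ : D) = ⟨φ, hφD⟩ ^ n * ⟨i, hiD⟩ * ⟨w, hwD⟩ :=
    Subtype.ext (by simp only [Subgroup.coe_mul, SubgroupClass.coe_pow]; exact hdeq)
  rw [e]
  exact U.mul_mem (U.mul_mem (U.pow_mem hφU n) hiU) hwU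

end Algebra

section Cohomology

variable {K : Type u} [Field K] [NumberField K]
variable (M : Type u) [AddCommGroup M] [DistribMulAction (absoluteGaloisGroup K) M]
  [TopologicalSpace M] [DiscreteTopology M] {v : HeightOneSpectrum (𝓞 K)}

/-- **`ker r_v ⊆ ker (H¹(D_v, M) → H¹(I_v, M)) ↪ M^{I_v}/(φ − 1)M^{I_v}`.** For a discrete
`Γ_K`-module `M` with continuous orbit maps, a finite place `v`, a subgroup `H ≥ I_v` (intended
`H = ker κ`: every `ℤ_p`-extension is unramified at `v ∤ p`) and an arithmetic Frobenius `φ ∈ D_v` at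
the chosen prime `𝔓₀ ∣ v`: the local kernel `localKer H M v = ker (H¹(D_v, M) → H¹(H ⊓ D_v, M))` is
finite with `#localKer ≤ #(M^{I_v}/(φ − 1)M^{I_v})` whenever the latter is finite (restriction to
`H ⊓ D_v` followed by restriction to `I_v`; the generic embedding `ResKernel.finite_subgroupResKer` on
the topological group `D_v`, its normal subgroup `I_v` and `φ`). Greenberg: "`ker r_v` … `⊆`
`H¹(K_v^{nr}/K_v, E(K_v^{nr})[p^∞])`". [cite: GreenbergLNM1716, §3 Lemma 3.3 (proof, p. 87)]
[cite: SerreGaloisCohomology1997, I.§2.6 (b)] -/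
theorem finite_localKer_and_natCard_le_inertia {H : Subgroup (absoluteGaloisGroup K)}
    (hIH : (adicCompletionPrime K v).inertia (absoluteGaloisGroup K) ≤ H)
    (hcont : ∀ m : M, Continuous fun σ : absoluteGaloisGroup K ↦ σ • m)
    {φ : absoluteGaloisGroup K} (hφ : IsArithFrobAt (𝓞 K) φ (adicCompletionPrime K v))
    [Finite (FixedPoints.addSubgroup ↥((adicCompletionPrime K v).inertia (absoluteGaloisGroup K)) M ⧸
      (inertiaSubOne M φ ((decomp_eq_decompositionSubgroup_adicCompletionPrime v).symm ▸
        hφ.mem_stabilizer)).range)] :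
    Finite (localKer H M v) ∧
      Nat.card (localKer H M v) ≤
        Nat.card (FixedPoints.addSubgroup
            ↥((adicCompletionPrime K v).inertia (absoluteGaloisGroup K)) M ⧸
          (inertiaSubOne M φ ((decomp_eq_decompositionSubgroup_adicCompletionPrime v).symm ▸
            hφ.mem_stabilizer)).range) := by
  haveI : (adicCompletionPrime K v).IsPrime := (adicCompletionPrime_mem_primesAbove K v).1
  have hφD' : φ ∈ decomp v :=
    (decomp_eq_decompositionSubgroup_adicCompletionPrime v).symm ▸ hφ.mem_stabilizer
  -- notation
  let I : Subgroup (absoluteGaloisGroup K) := (adicCompletionPrime K v).inertia (absoluteGaloisGroup K)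
  let D : Subgroup (absoluteGaloisGroup K) := (⊤ : Subgroup (absoluteGaloisGroup K)) ⊓ decomp v
  let N : Subgroup D := I.subgroupOf D
  have hIdec : I ≤ decomp v := by
    intro i hi
    rw [decomp_eq_decompositionSubgroup_adicCompletionPrime]
    exact Ideal.inertia_le_decompositionSubgroup _ _ hi
  have hID : I ≤ D := fun i hi ↦ Subgroup.mem_inf.mpr ⟨Subgroup.mem_top i, hIdec hi⟩
  have hφD : φ ∈ D := Subgroup.mem_inf.mpr ⟨Subgroup.mem_top φ, hφD'⟩
  let g : D := ⟨φ, hφD⟩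
  -- `N ⊴ D`
  haveI hN : N.Normal := by
    refine (Subgroup.normal_subgroupOf_iff hID).mpr fun i d hi hd ↦ ?_
    have h := conj_mem_inertia_of_mem_decomp (v := v) (inv_mem (Subgroup.mem_inf.mp hd).2) hi
    rwa [inv_inv] at h
  -- (1) orbit maps on `D_v` are continuous
  have hcont' : ∀ m : M, Continuous fun x : D ↦ x • m := fun m ↦
    (hcont m).comp continuous_subtype_val
  -- (2) `M^N = M^{I_v}`, compatibly with `φ − 1`
  have hfix : FixedPoints.addSubgroup N M = FixedPoints.addSubgroup ↥I M := by
    ext m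
    simp only [FixedPoints.mem_addSubgroup]
    constructor
    · intro h x
      exact h ⟨⟨(x : absoluteGaloisGroup K), hID x.2⟩, Subgroup.mem_subgroupOf.mpr x.2⟩
    · intro h x
      exact h ⟨((x : D) : absoluteGaloisGroup K), Subgroup.mem_subgroupOf.mp x.2⟩
  let e : FixedPoints.addSubgroup N M ≃+ FixedPoints.addSubgroup ↥I M :=
    AddEquiv.addSubgroupCongr hfix
  have he : AddSubgroup.map (e : FixedPoints.addSubgroup N M →+ FixedPoints.addSubgroup ↥I M)
      (subOne N M g).range = (inertiaSubOne M φ hφD').range := by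
    ext b
    constructor
    · rintro ⟨x, ⟨y, rfl⟩, rfl⟩
      exact ⟨e y, Subtype.ext rfl⟩
    · rintro ⟨y, rfl⟩
      exact ⟨subOne N M g (e.symm y), ⟨e.symm y, rfl⟩, Subtype.ext rfl⟩
  let eq : FixedPoints.addSubgroup N M ⧸ (subOne N M g).range ≃+
      FixedPoints.addSubgroup ↥I M ⧸ (inertiaSubOne M φ hφD').range :=
    QuotientAddGroup.congr _ _ e he
  haveI : Finite (FixedPoints.addSubgroup N M ⧸ (subOne N M g).range) :=
    Finite.of_equiv _ eq.toEquiv.symm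
  have hcard : Nat.card (FixedPoints.addSubgroup N M ⧸ (subOne N M g).range) =
      Nat.card (FixedPoints.addSubgroup ↥I M ⧸ (inertiaSubOne M φ hφD').range) :=
    Nat.card_congr eq.toEquiv
  -- (3) the generic embedding `ker res ↪ M^N/(φ − 1)M^N` on `D_v`
  obtain ⟨hfinK, hcardK⟩ :=
    ResKernel.finite_subgroupResKer N M g (inertia_frobenius_generate hφ hφD) hcont'
  haveI := hfinK
  -- (4) `localKer ⊆ ker (res : H¹(D_v, M) → H¹(N, M))`
  have hker : localKer H M v ≤ subgroupResKer M N := by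
    intro c hc
    -- `res_{D → N}` factors through `res_{D → H ⊓ D_v}`
    have hIHD : I ≤ H ⊓ decomp v := le_inf hIH hIdec
    let j : N →ₜ* ↥I :=
      { toFun := fun x ↦ ⟨((x : D) : absoluteGaloisGroup K), Subgroup.mem_subgroupOf.mp x.2⟩
        map_one' := rfl
        map_mul' := fun _ _ ↦ rfl
        continuous_toFun :=
          (continuous_subtype_val.comp continuous_subtype_val).subtype_mk _ }
    have hcomp : (resH1Hom j (AddMonoidHom.id M) (fun _ _ ↦ rfl)).comp
        ((resOfLe M hIHD).comp
          (resOfLe M (inf_le_inf_right (decomp v) (le_top : H ≤ ⊤)))) = resSubgroup N M := by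
      unfold Literature.NumberTheory.EllipticCurves.resOfLe ResKernel.resSubgroup
      rw [resH1Hom_comp, resH1Hom_comp]
      exact resH1Hom_congr (ContinuousMonoidHom.ext fun _ ↦ rfl) (AddMonoidHom.ext fun _ ↦ rfl) _ _
    rw [mem_subgroupResKer_iff, ← hcomp, AddMonoidHom.comp_apply, AddMonoidHom.comp_apply,
      (AddMonoidHom.mem_ker).mp hc, map_zero, map_zero]
  have hinj := AddSubgroup.inclusion_injective hker
  exact ⟨Finite.of_injective _ hinj,
    (Nat.card_le_card_of_injective _ hinj).trans (hcardK.trans hcard.le)⟩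

end Cohomology

/-! ## Elliptic curves: `ker(φ − 1) = E(K̄)^{D_v}` on `E(K̄)^{I_v}` and the Tamagawa algebra -/

section Curve

variable {K : Type u} [Field K] [NumberField K] (W : WeierstrassCurve K) {p : ℕ} [Fact p.Prime]
  {v : HeightOneSpectrum (𝓞 K)}

/-- **`ker (φ − 1) = E(K̄)^{D_v}` on `E(K̄)^{I_v}`**: a point fixed by `I_v` and by an arithmetic
Frobenius `φ` at `𝔓₀` is fixed by all of `D_v` (its stabiliser is open,
`WeierstrassCurve.isOpen_stabilizer_point_holds`; Frobenius generation). Greenberg: "the kernel of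
`Frob − 1` on `E(K_v^{nr})` is `E(K_v)`". [cite: GreenbergLNM1716, §3 Lemma 3.3 (proof, p. 87)] -/
theorem inertiaSubOne_eq_zero_iff {φ : absoluteGaloisGroup K}
    (hφ : IsArithFrobAt (𝓞 K) φ (adicCompletionPrime K v)) (hφD : φ ∈ decomp v)
    (m : FixedPoints.addSubgroup ↥((adicCompletionPrime K v).inertia (absoluteGaloisGroup K))
      W.geomPoints) :
    inertiaSubOne W.geomPoints φ hφD m = 0 ↔ ∀ x ∈ decomp v, x • (m : W.geomPoints) = m := by
  constructor
  · intro h x hx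
    have hgm : φ • (m : W.geomPoints) = m := by
      have h1 := congrArg (fun z : FixedPoints.addSubgroup
        ↥((adicCompletionPrime K v).inertia (absoluteGaloisGroup K)) W.geomPoints ↦
          (z : W.geomPoints)) h
      simp only [coe_inertiaSubOne_apply, ZeroMemClass.coe_zero, sub_eq_zero] at h1
      exact h1
    have hφD' : φ ∈ (⊤ : Subgroup (absoluteGaloisGroup K)) ⊓ decomp v :=
      Subgroup.mem_inf.mpr ⟨Subgroup.mem_top φ, hφD⟩
    let U : Subgroup ↥((⊤ : Subgroup (absoluteGaloisGroup K)) ⊓ decomp v) :=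
      (MulAction.stabilizer (absoluteGaloisGroup K) (m : W.geomPoints)).subgroupOf _
    have hU : IsOpen (U : Set ↥((⊤ : Subgroup (absoluteGaloisGroup K)) ⊓ decomp v)) :=
      (W.isOpen_stabilizer_point_holds (m : W.geomPoints)).preimage continuous_subtype_val
    have hIU : ((adicCompletionPrime K v).inertia (absoluteGaloisGroup K)).subgroupOf
        ((⊤ : Subgroup (absoluteGaloisGroup K)) ⊓ decomp v) ≤ U := by
      intro x hx
      rw [Subgroup.mem_subgroupOf, MulAction.mem_stabilizer_iff]
      exact m.2 ⟨(x : absoluteGaloisGroup K), Subgroup.mem_subgroupOf.mp hx⟩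
    have hgU : (⟨φ, hφD'⟩ : ↥((⊤ : Subgroup (absoluteGaloisGroup K)) ⊓ decomp v)) ∈ U := by
      rw [Subgroup.mem_subgroupOf, MulAction.mem_stabilizer_iff]
      exact hgm
    have htop := inertia_frobenius_generate hφ hφD' U hU hIU hgU
    have hxU : (⟨x, Subgroup.mem_inf.mpr ⟨Subgroup.mem_top x, hx⟩⟩ :
        ↥((⊤ : Subgroup (absoluteGaloisGroup K)) ⊓ decomp v)) ∈ U := by
      rw [htop]; exact Subgroup.mem_top _
    rw [Subgroup.mem_subgroupOf, MulAction.mem_stabilizer_iff] at hxU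
    exact hxU
  · intro h
    apply Subtype.ext
    rw [coe_inertiaSubOne_apply, ZeroMemClass.coe_zero, sub_eq_zero]
    exact h _ hφD

/-- **`E[p^∞]^{I_v}` is the `p`-primary component of `E(K̄)^{I_v}`** (same points). [folklore] -/
def fixedPrimaryEquivInertia :
    FixedPoints.addSubgroup ↥((adicCompletionPrime K v).inertia (absoluteGaloisGroup K))
        (W.geomPrimaryTorsion p) ≃+
      AddCommGroup.primaryComponent
        ↥(FixedPoints.addSubgroup ↥((adicCompletionPrime K v).inertia (absoluteGaloisGroup K))
          W.geomPoints) p where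
  toFun b := ⟨⟨((b : W.geomPrimaryTorsion p) : W.geomPoints), fun x ↦ by
      have h := congrArg (fun z : W.geomPrimaryTorsion p ↦ (z : W.geomPoints)) (b.2 x)
      simpa only [Subgroup.smul_def, primaryComponent.coe_smul] using h⟩, by
      obtain ⟨k, hk⟩ := (AddCommGroup.mem_primaryComponent (G := W.geomPoints)).mp
        (b : W.geomPrimaryTorsion p).2
      exact (AddCommGroup.mem_primaryComponent).mpr ⟨k, Subtype.ext (by
        rw [AddSubgroupClass.coe_nsmul, ZeroMemClass.coe_zero]; exact hk)⟩⟩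
  invFun m := ⟨⟨((m : FixedPoints.addSubgroup
      ↥((adicCompletionPrime K v).inertia (absoluteGaloisGroup K)) W.geomPoints) : W.geomPoints), by
      obtain ⟨k, hk⟩ := (AddCommGroup.mem_primaryComponent).mp m.2
      exact (AddCommGroup.mem_primaryComponent).mpr ⟨k, by
        have h := congrArg (fun z : FixedPoints.addSubgroup
          ↥((adicCompletionPrime K v).inertia (absoluteGaloisGroup K)) W.geomPoints ↦
            (z : W.geomPoints)) hk
        simpa only [AddSubgroupClass.coe_nsmul, ZeroMemClass.coe_zero] using h⟩⟩, fun x ↦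
      Subtype.ext (by
        rw [Subgroup.smul_def, primaryComponent.coe_smul]
        exact (m : FixedPoints.addSubgroup
          ↥((adicCompletionPrime K v).inertia (absoluteGaloisGroup K)) W.geomPoints).2 x)⟩
  left_inv b := rfl
  right_inv m := rfl
  map_add' a b := rfl

end Curve

end Summit.BirchSwinnertonDyer.Rank1Residual.X11b.AcSelmer

end
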